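import Summits.Ventures.PackingBounds.Conjectures.DiploSimplexRiesz
import Summits.Ventures.PackingBounds.Energy.DiploSimplexAntipodalRigid

/-!
# Conjectures A / B hold among ANTIPODAL configurations — every `n ≥ 3`, every `s` (wiring file)

Framing: lottery ticket; floor = certified bounds/negative ranges. Venture `PackingBounds` (cell `pub-packcert`, seat
`pub-packcert-energy`, gen 26). Dictionary between the distance form of `Conjectures/DiploSimplexRiesz.lean`
(`Σ ‖x - y‖^{-s}`, `dipValue n s`) and the inner-product form of `Energy/DiploSimplexAntipodal*.lean`
(`Σ (2 - 2⟪x,y⟫)^{-p}`, `p = s/2`): for unit vectors `‖x - y‖^{-s} = (2 - 2⟪x,y⟫)^{-s/2}` (`norm_sub_rpow_neg`) and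
`dipValue n s = (2n+2)(4^{-s/2} + n(2+2/n)^{-s/2} + n(2-2/n)^{-s/2})` (`dipValue_eq_inner_form`). Consequences, for every
`n ≥ 3`: every ANTIPODAL `(2n+2)`-configuration of `S^{n-1}` has Riesz-`s` energy `≥ dipValue n s` for every `s ≥ 0`
(`dipValue_le_of_antipodal`), and for `s > 0` energy `≤ dipValue n s` forces the node set `{-1, ±1/n}`
(`nodeset_of_antipodal_le`) — i.e. the statements `DiploMinimises n s` / `DiploRigid n s` of Conjectures A / B hold when
restricted to antipodal competitors, in every dimension (Cohn–Kumar 2007 §8; Cohn–Woo 2012 §5.2; the kernel proofs are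
`DiploSimplexAntipodal.riesz_energy_ge` / `riesz_nodeset_of_energy_le`). The conjectures proper concern ALL competitors.

## References
* H. Cohn, A. Kumar, J. Amer. Math. Soc. 20 (2007) 99–148, §8. [`CohnKumar2006`]
* B. Ballinger et al., Experiment. Math. 18 (2009) 257–283, §3.4. [`BallingerEtAl2009`]
-/

noncomputable section

open Finset
open scoped RealInnerProductSpace

namespace Summit.Ventures.PackingBounds.Conjectures

open Summit.Ventures.PackingBounds.Energy

variable {n : ℕ}

/-- For unit vectors: `‖x - y‖^{-s} = (2 - 2⟪x,y⟫)^{-(s/2)}`. [folklore] -/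
theorem norm_sub_rpow_neg {x y : EuclideanSpace ℝ (Fin n)} (hx : ‖x‖ = 1) (hy : ‖y‖ = 1) (s : ℝ) :
    ‖x - y‖ ^ (-s) = (2 - 2 * inner ℝ x y) ^ (-(s / 2)) := by
  have h2 : 0 ≤ 2 - 2 * inner ℝ x y := by
    have hsq : ‖x - y‖ ^ 2 = 2 - 2 * inner ℝ x y := by rw [norm_sub_sq_real, hx, hy]; ring
    rw [← hsq]; positivity
  rw [Config.DiploSimplex.norm_sub_eq_sqrt hx hy, Real.sqrt_eq_rpow, ← Real.rpow_mul h2]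
  congr 1
  ring

/-- `√q ^ {-s} = q ^ {-(s/2)}` for `q ≥ 0`. [folklore] -/
theorem sqrt_rpow_neg {q : ℝ} (hq : 0 ≤ q) (s : ℝ) : Real.sqrt q ^ (-s) = q ^ (-(s / 2)) := by
  rw [Real.sqrt_eq_rpow, ← Real.rpow_mul hq]
  congr 1
  ring

/-- `dipValue` in inner-product form: `dipValue n s = (2n+2)(4^{-s/2} + n (2+2/n)^{-s/2} + n (2-2/n)^{-s/2})` (`n ≥ 1`). -/
theorem dipValue_eq_inner_form (hn : 1 ≤ n) (s : ℝ) : dipValue n s =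
    (2 * n + 2 : ℝ) * ((4 : ℝ) ^ (-(s / 2)) + n * (2 + 2 / (n : ℝ)) ^ (-(s / 2)) + n * (2 - 2 / (n : ℝ)) ^ (-(s / 2))) := by
  have hn1 : (1 : ℝ) ≤ n := by exact_mod_cast hn
  have hnpos : (0 : ℝ) < n := by linarith
  have hp : 0 ≤ 2 + 2 / (n : ℝ) := by positivity
  have hm : 0 ≤ 2 - 2 / (n : ℝ) := by
    have : 2 / (n : ℝ) ≤ 2 := by rw [div_le_iff₀ hnpos]; linarith
    linarith
  have h4 : (4 : ℝ) ^ (-(s / 2)) = (2 : ℝ) ^ (-s) := by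
    rw [show (4 : ℝ) = 2 ^ (2 : ℝ) by norm_num, ← Real.rpow_mul (by norm_num)]
    congr 1
    ring
  rw [dipValue, sqrt_rpow_neg hp, sqrt_rpow_neg hm, h4]

open scoped Classical in
/-- **Antipodal configurations obey Conjecture A/B's inequality in every dimension** (`n ≥ 3`, `s ≥ 0`): every antipodal
`(2n+2)`-configuration of `S^{n-1}` has `Σ_{x ≠ y} ‖x - y‖^{-s} ≥ dipValue n s`. [cite: CohnKumar2006, §8] -/
theorem dipValue_le_of_antipodal (hn : 3 ≤ n) (s : ℝ) (hs : 0 ≤ s) (C : Finset (EuclideanSpace ℝ (Fin n)))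
    (hc : C.card = 2 * n + 2) (h1 : ∀ x ∈ C, ‖x‖ = 1) (hanti : ∀ x ∈ C, -x ∈ C) :
    dipValue n s ≤ ∑ x ∈ C, ∑ y ∈ C.erase x, ‖x - y‖ ^ (-s) := by
  have h := DiploSimplexAntipodal.riesz_energy_ge hn (s / 2) (by linarith) C h1 hc hanti
  rw [dipValue_eq_inner_form (by omega)]
  refine le_trans (le_of_eq rfl) (le_trans h (le_of_eq ?_))
  refine sum_congr rfl fun x hx => sum_congr rfl fun y hy => ?_
  rw [norm_sub_rpow_neg (h1 x hx) (h1 y (mem_of_mem_erase hy))]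

open scoped Classical in
/-- **Antipodal rigidity in every dimension** (`n ≥ 3`, `s > 0`): an antipodal `(2n+2)`-configuration of `S^{n-1}` with
`Σ_{x ≠ y} ‖x - y‖^{-s} ≤ dipValue n s` has all pairwise inner products in `{-1, -1/n, 1/n}` (hence is isometric to the
diplo-simplex, `Config.DiploSimplexUnique.isometric_of_nodesets`). [cite: BallingerEtAl2009, §3.4] -/
theorem nodeset_of_antipodal_le (hn : 3 ≤ n) (s : ℝ) (hs : 0 < s) (C : Finset (EuclideanSpace ℝ (Fin n)))
    (hc : C.card = 2 * n + 2) (h1 : ∀ x ∈ C, ‖x‖ = 1) (hanti : ∀ x ∈ C, -x ∈ C)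
    (hle : ∑ x ∈ C, ∑ y ∈ C.erase x, ‖x - y‖ ^ (-s) ≤ dipValue n s) :
    ∀ x ∈ C, ∀ y ∈ C, x ≠ y →
      inner ℝ x y = -1 ∨ inner ℝ x y = -1 / (n : ℝ) ∨ inner ℝ x y = 1 / (n : ℝ) := by
  refine DiploSimplexAntipodal.riesz_nodeset_of_energy_le hn (s / 2) (by linarith) C h1 hc hanti ?_
  rw [dipValue_eq_inner_form (by omega)] at hle
  refine le_trans (le_of_eq ?_) hle
  refine sum_congr rfl fun x hx => sum_congr rfl fun y hy => ?_
  rw [norm_sub_rpow_neg (h1 x hx) (h1 y (mem_of_mem_erase hy))]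

open scoped Classical in
/-- **Uniqueness among antipodal configurations, every `n ≥ 3`, every `s > 0`:** any two antipodal `(2n+2)`-configurations of
`S^{n-1}` with Riesz-`s` energy `≤ dipValue n s` are isometric. [cite: BallingerEtAl2009, §3.4] -/
theorem antipodal_minimisers_isometric (hn : 3 ≤ n) (s : ℝ) (hs : 0 < s) (C C' : Finset (EuclideanSpace ℝ (Fin n)))
    (hc : C.card = 2 * n + 2) (h1 : ∀ x ∈ C, ‖x‖ = 1) (hanti : ∀ x ∈ C, -x ∈ C)
    (hle : ∑ x ∈ C, ∑ y ∈ C.erase x, ‖x - y‖ ^ (-s) ≤ dipValue n s)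
    (hc' : C'.card = 2 * n + 2) (h1' : ∀ x ∈ C', ‖x‖ = 1) (hanti' : ∀ x ∈ C', -x ∈ C')
    (hle' : ∑ x ∈ C', ∑ y ∈ C'.erase x, ‖x - y‖ ^ (-s) ≤ dipValue n s) :
    ∃ Ψ : EuclideanSpace ℝ (Fin n) ≃ₗᵢ[ℝ] EuclideanSpace ℝ (Fin n), C' = C.image Ψ :=
  Config.DiploSimplexUnique.isometric_of_nodesets hn C C' h1 hc (nodeset_of_antipodal_le hn s hs C hc h1 hanti hle)
    h1' hc' (nodeset_of_antipodal_le hn s hs C' hc' h1' hanti' hle')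

end Summit.Ventures.PackingBounds.Conjectures

end
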